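import Summits.AtomisticToContinuum.HydrodynamicLimit.Theorems.UGibbsSRBRigidityTemperedCollisionsLiftWeight
import Summits.AtomisticToContinuum.HydrodynamicLimit.Theorems.UGibbsSRBRigidityTemperedCollisionsKinematics
import HarnessLib

/-!
# `UGibbsSRBRigidity.TemperedCollisions` (stmt-AtomisticToContinuum-9391), step 4:
# the law-free majorant of the tempered collision sum and the reduction to one-window bounds

Helper file (`--supports stmt-AtomisticToContinuum-9391`).  The item's collision functional over `[0, τ]` — the sum
over the collision times of `Σ_{p ≠ q} 𝟙_{contact (p,q)} ε/|⟨n, v_p − v_q⟩|`, i.e. `2/|ŵ_n|` per binary collision —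
is dominated ON EVERY GOOD ORBIT by `liminf_m Σ_{k < 2^m} W_m(Φ_{k h_m} z)`, `h_m = τ/2^m`, where
`W_m = Σ_{p ≠ q} g_m(x_p − x_q, v_p − v_q)` is the pair sum of the lifted weight of step 2
(`exists_temperedSum_majorant`: once the dyadic mesh is finer than the gap between the finitely many collision
times, each collision is alone in its window, the stretch from the window start is collision-free, step 3 applies,
and distinct collisions occupy distinct windows — the argument of the collision COUNT majorant of
`JParityClosureCollisionTightnessRung0`, now weighted).  Fatou then bounds the lower Lebesgue integral under ANY law
carried by the good set by `liminf_m Σ_k ∫ W_m ∘ Φ_{k h_m}` (`lintegral_temperedSum_le_liminf`): the reduction of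
`TemperedCollisions` to bounds on one-window pair functionals ALONG THE EVOLVED LAW.  No invariance is used here.

References: C. Cercignani, R. Illner, M. Pulvirenti (1994), App. 4.A; I. Gallagher, L. Saint-Raymond, B. Texier
(2013), Prop. 4.1.1.
-/

noncomputable section

open MeasureTheory Set Filter Topology
open scoped ENNReal InnerProductSpace

namespace Summit.AtomisticToContinuum.HydrodynamicLimit.Theorems

open Literature.Analysis.FluidPDE Literature.MathematicalPhysics.KineticTheory
open Literature.Analysis.FunctionSpaces

/-! ### The law-free majorant of the tempered collision sum -/

/-- The pair sum of a jointly measurable weight is a measurable function of the configuration. [folklore] -/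
theorem measurable_pairSum {N : ℕ} {g : T3 → V3 → ℝ≥0∞} (hg : Measurable (Function.uncurry g)) :
    Measurable fun w : Config N (Fin 3) T3 =>
      ∑ p : Fin N, ∑ q ∈ Finset.univ.erase p, g ((w p).1 - (w q).1) ((w p).2 - (w q).2) := by
  refine Finset.measurable_sum _ fun p _ => Finset.measurable_sum _ fun q _ => ?_
  change Measurable fun w : Config N (Fin 3) T3 =>
    Function.uncurry g ((w p).1 - (w q).1, (w p).2 - (w q).2)
  exact hg.comp (((measurable_pi_apply p).fst.sub (measurable_pi_apply q).fst).prodMk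
    ((measurable_pi_apply p).snd.sub (measurable_pi_apply q).snd))

/-- The collision mark of the item at a configuration is nonnegative. [folklore] -/
theorem mark_nonneg {ε : ℝ} (hε : 0 ≤ ε) {N : ℕ} (y : Config N (Fin 3) T3) :
    0 ≤ ∑ p : Fin N, ∑ q ∈ Finset.univ.erase p,
      (contactSet (Torus.geometry (Fin 3)) N ε p q).indicator
        (fun y : Config N (Fin 3) T3 =>
          ε / |⟪(Torus.geometry (Fin 3)).sepVec (y p).1 (y q).1, (y p).2 - (y q).2⟫_ℝ|) y :=
  Finset.sum_nonneg fun _ _ => Finset.sum_nonneg fun _ _ =>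
    Set.indicator_nonneg (fun _ _ => div_nonneg hε (abs_nonneg _)) _

/-- **The law-free majorant of the tempered collision sum** (Cercignani–Illner–Pulvirenti one-window argument,
weighted).  For a hard-sphere flow `Φ` of `N` spheres of diameter `ε > 0` on `𝕋³` and a horizon `τ > 0` there are
lifted pair weights `g_m` (`exists_liftWeight` at the dyadic window lengths `h_m = τ/2^m`: jointly measurable, Haar
integral in the relative position `≤ 2π ε² h_m` whatever the relative velocity and the centre) such that ON EVERY
GOOD ORBIT the item's collision functional — the sum over the collision times `t ∈ [0, τ]` of
`Σ_{p ≠ q} 𝟙_{contact (p,q)}(Φ_t z) · ε/|⟨n, v_p − v_q⟩|` (each binary collision contributes `2/|ŵ_n|`) — is at most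
`liminf_m Σ_{k < 2^m} W_m(Φ_{k h_m} z)`, `W_m(w) = Σ_{p ≠ q} g_m(x_p − x_q, v_p − v_q)`: once the mesh is finer than
the (positive) gap between the finitely many collision times, the collision at `t` is the only one in its window
`[k h_m, (k+1) h_m]`, the stretch `(k h_m, t)` is collision-free, and the mark is dominated by the weight read at
the window start (`ofReal_indicator_mark_le`); distinct collision times occupy distinct windows.  No law, no
invariance and no measurability of the collision functional enter. [folklore] -/
theorem exists_temperedSum_majorant {ε : ℝ} (hε : 0 < ε) {N : ℕ}
    (Φ : HardSphereFlow (Torus.geometry (Fin 3)) ε N) {τ : ℝ} (hτ : 0 < τ) :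
    ∃ g : ℕ → T3 → V3 → ℝ≥0∞,
      (∀ m, Measurable (Function.uncurry (g m))) ∧
      (∀ m (c : T3) (u : V3), ∫⁻ y, g m (y - c) u ≤ ENNReal.ofReal (2 * Real.pi * ε ^ 2 * (τ / 2 ^ m))) ∧
      ∀ z ∈ Φ.good,
        ENNReal.ofReal (∑ᶠ t ∈ collisionTimes (Torus.geometry (Fin 3)) ε (fun s => Φ.flow s z) ∩ Icc 0 τ,
            ∑ p : Fin N, ∑ q ∈ Finset.univ.erase p,
              (contactSet (Torus.geometry (Fin 3)) N ε p q).indicator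
                (fun y : Config N (Fin 3) T3 =>
                  ε / |⟪(Torus.geometry (Fin 3)).sepVec (y p).1 (y q).1, (y p).2 - (y q).2⟫_ℝ|) (Φ.flow t z)) ≤
          liminf (fun m => ∑ k ∈ Finset.range (2 ^ m), ∑ p : Fin N, ∑ q ∈ Finset.univ.erase p,
            g m ((Φ.flow (k * (τ / 2 ^ m)) z p).1 - (Φ.flow (k * (τ / 2 ^ m)) z q).1)
              ((Φ.flow (k * (τ / 2 ^ m)) z p).2 - (Φ.flow (k * (τ / 2 ^ m)) z q).2)) atTop := by
  choose g hgm hgint hgdom using fun m : ℕ => exists_liftWeight hε (h := τ / 2 ^ m) (by positivity)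
  refine ⟨g, hgm, hgint, ?_⟩
  intro z hz
  -- the mark at a configuration
  set M : Config N (Fin 3) T3 → ℝ := fun y => ∑ p : Fin N, ∑ q ∈ Finset.univ.erase p,
    (contactSet (Torus.geometry (Fin 3)) N ε p q).indicator
      (fun y : Config N (Fin 3) T3 => ε / |⟪(Torus.geometry (Fin 3)).sepVec (y p).1 (y q).1, (y p).2 - (y q).2⟫_ℝ|) y with hM
  have hM0 : ∀ y, 0 ≤ M y := fun y => mark_nonneg hε.le y
  -- the window functional
  set W : ℕ → Config N (Fin 3) T3 → ℝ≥0∞ := fun m w => ∑ p : Fin N, ∑ q ∈ Finset.univ.erase p,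
    g m ((w p).1 - (w q).1) ((w p).2 - (w q).2) with hW
  have htraj : IsHardSphereTrajectory (Torus.geometry (Fin 3)) ε N fun s => Φ.flow s z := Φ.isTrajectory z hz
  have hfin : (collisionTimes (Torus.geometry (Fin 3)) ε (fun s => Φ.flow s z) ∩ Icc 0 τ).Finite := htraj.locFinite 0 τ
  set CT := hfin.toFinset with hCT
  have hCTmem : ∀ t ∈ CT, t ∈ collisionTimes (Torus.geometry (Fin 3)) ε (fun s => Φ.flow s z) ∧ t ∈ Icc 0 τ := fun t ht =>
    hfin.mem_toFinset.1 ht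
  -- the functional as a finite sum of `ofReal`s
  have hF : ENNReal.ofReal (∑ᶠ t ∈ collisionTimes (Torus.geometry (Fin 3)) ε (fun s => Φ.flow s z) ∩ Icc 0 τ, M (Φ.flow t z)) =
      ∑ t ∈ CT, ENNReal.ofReal (M (Φ.flow t z)) := by
    rw [finsum_mem_eq_finite_toFinset_sum _ hfin, ENNReal.ofReal_sum_of_nonneg fun t _ => hM0 _]
  change ENNReal.ofReal (∑ᶠ t ∈ collisionTimes (Torus.geometry (Fin 3)) ε (fun s => Φ.flow s z) ∩ Icc 0 τ, M (Φ.flow t z)) ≤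
    liminf (fun m => ∑ k ∈ Finset.range (2 ^ m), W m (Φ.flow (k * (τ / 2 ^ m)) z)) atTop
  rw [hF]
  -- a positive gap between distinct collision times
  obtain ⟨g0, hg0, hgap⟩ : ∃ g0 : ℝ, 0 < g0 ∧ ∀ t ∈ CT, ∀ t' ∈ CT, t ≠ t' → g0 ≤ |t - t'| := by
    by_cases hne : CT.offDiag.Nonempty
    · refine ⟨CT.offDiag.inf' hne (fun p => |p.1 - p.2|), ?_, ?_⟩
      · rw [Finset.lt_inf'_iff]
        intro p hp
        rw [Finset.mem_offDiag] at hp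
        exact abs_pos.2 (sub_ne_zero.2 hp.2.2)
      · intro t ht t' ht' htt'
        have hp : (t, t') ∈ CT.offDiag := Finset.mem_offDiag.2 ⟨ht, ht', htt'⟩
        exact Finset.inf'_le (fun p : ℝ × ℝ => |p.1 - p.2|) hp
    · refine ⟨1, one_pos, fun t ht t' ht' htt' => ?_⟩
      have hp : (t, t') ∈ CT.offDiag := Finset.mem_offDiag.2 ⟨ht, ht', htt'⟩
      exact absurd ⟨(t, t'), hp⟩ hne
  -- eventually the mesh is below the gap
  obtain ⟨m₀, hm₀⟩ := exists_nat_gt (τ / g0)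
  have hmesh : ∀ m : ℕ, m₀ ≤ m → τ / 2 ^ m < g0 := by
    intro m hm
    have h2m : (m : ℝ) < 2 ^ m := by exact_mod_cast Nat.lt_two_pow_self
    have h1 : τ / g0 < 2 ^ m := hm₀.trans_le ((Nat.cast_le.2 hm).trans h2m.le)
    rw [div_lt_iff₀ hg0] at h1
    rw [div_lt_iff₀ (by positivity)]
    linarith
  refine le_liminf_of_le (h := Filter.eventually_atTop.2 ⟨m₀, fun m hm => ?_⟩)
  -- a fixed fine scale `m`
  set hm' : ℝ := τ / 2 ^ m with hhm
  have hh0 : 0 < hm' := by positivity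
  have hhg : hm' < g0 := hmesh m hm
  have h2pow : ((2 ^ m - 1 : ℕ) : ℝ) + 1 = 2 ^ m := by
    have : 1 ≤ 2 ^ m := Nat.one_le_two_pow
    rw [Nat.cast_sub this]
    push_cast
    ring
  set f : ℝ → ℕ := fun t => min ⌊t / hm'⌋₊ (2 ^ m - 1) with hf
  have hf1 : ∀ t, f t < 2 ^ m := fun t =>
    (min_le_right _ _).trans_lt (Nat.sub_lt Nat.one_le_two_pow one_pos)
  have hf2 : ∀ t, 0 ≤ t → (f t : ℝ) * hm' ≤ t := by
    intro t ht0
    have h1 : ((f t : ℕ) : ℝ) ≤ ⌊t / hm'⌋₊ := by exact_mod_cast min_le_left _ _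
    calc (f t : ℝ) * hm' ≤ ⌊t / hm'⌋₊ * hm' := mul_le_mul_of_nonneg_right h1 hh0.le
      _ ≤ t / hm' * hm' := mul_le_mul_of_nonneg_right (Nat.floor_le (by positivity)) hh0.le
      _ = t := div_mul_cancel₀ t hh0.ne'
  have hf3 : ∀ t, t ≤ τ → t ≤ ((f t : ℝ) + 1) * hm' := by
    intro t htτ
    by_cases hcase : ⌊t / hm'⌋₊ ≤ 2 ^ m - 1
    · have hft : f t = ⌊t / hm'⌋₊ := min_eq_left hcase
      rw [hft]
      have := Nat.lt_floor_add_one (t / hm')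
      rw [div_lt_iff₀ hh0] at this
      exact this.le
    · have hft : f t = 2 ^ m - 1 := min_eq_right (le_of_not_ge hcase)
      rw [hft, h2pow, hhm, mul_div_cancel₀ τ (by positivity)]
      exact htτ
  -- `f` is monotone along a window: `f t * h < r < t` forces `f r = f t`
  have hfeq : ∀ t r : ℝ, (f t : ℝ) * hm' < r → r < t → f r = f t := by
    intro t r h1 h2
    apply le_antisymm
    · exact min_le_min (Nat.floor_mono (div_le_div_of_nonneg_right h2.le hh0.le)) le_rfl
    · refine le_min ?_ (min_le_right _ _)
      refine Nat.le_floor ?_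
      rw [le_div_iff₀ hh0]
      exact h1.le
  have hinj : Set.InjOn f CT := by
    intro t ht t' ht' hff
    by_contra htt'
    have hle : g0 ≤ |t - t'| := hgap t ht t' ht' htt'
    obtain ⟨-, ht0, htτ⟩ := hCTmem t ht
    obtain ⟨-, ht0', htτ'⟩ := hCTmem t' ht'
    have h1 := hf2 t ht0
    have h2 := hf3 t htτ
    have h3 := hf2 t' ht0'
    have h4 := hf3 t' htτ'
    rw [hff] at h1 h2
    have habs : |t - t'| ≤ hm' := by
      rw [abs_le]
      constructor <;> nlinarith
    linarith
  -- the stretch before each collision time of `[0, τ]` is collision-free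
  have hfree : ∀ t ∈ CT, ∀ r ∈ Ioo ((f t : ℝ) * hm') t, r ∉ collisionTimes (Torus.geometry (Fin 3)) ε (fun s => Φ.flow s z) := by
    intro t ht r hr hrc
    obtain ⟨-, ht0, htτ⟩ := hCTmem t ht
    have hrCT : r ∈ CT := by
      rw [hCT, hfin.mem_toFinset]
      refine ⟨hrc, ?_, (hr.2.le.trans htτ)⟩
      exact le_trans (by positivity) hr.1.le
    have hfr : f r = f t := hfeq t r hr.1 hr.2
    exact absurd (hinj hrCT ht hfr) (ne_of_lt hr.2)
  -- each collision mark is dominated by the window functional at its window start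
  have hmark : ∀ t ∈ CT, ENNReal.ofReal (M (Φ.flow t z)) ≤ W m (Φ.flow ((f t : ℝ) * hm') z) := by
    intro t ht
    obtain ⟨-, ht0, htτ⟩ := hCTmem t ht
    have hat : t ∈ Icc ((f t : ℝ) * hm') ((f t : ℝ) * hm' + hm') :=
      ⟨hf2 t ht0, by linarith [hf3 t htτ]⟩
    simp only [hM, hW]
    rw [ENNReal.ofReal_sum_of_nonneg fun p _ => Finset.sum_nonneg fun q _ =>
      Set.indicator_nonneg (fun _ _ => div_nonneg hε.le (abs_nonneg _)) _]
    refine Finset.sum_le_sum fun p _ => ?_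
    rw [ENNReal.ofReal_sum_of_nonneg fun q _ =>
      Set.indicator_nonneg (fun _ _ => div_nonneg hε.le (abs_nonneg _)) _]
    refine Finset.sum_le_sum fun q hq => ?_
    have hpq : p ≠ q := (Finset.ne_of_mem_erase hq).symm
    exact ofReal_indicator_mark_le hε (hgdom m) htraj hat (hfree t ht) hpq
  -- summing over the collision times, distinct windows
  calc ∑ t ∈ CT, ENNReal.ofReal (M (Φ.flow t z))
      ≤ ∑ t ∈ CT, W m (Φ.flow ((f t : ℝ) * hm') z) := Finset.sum_le_sum hmark
    _ = ∑ k ∈ CT.image f, W m (Φ.flow ((k : ℝ) * hm') z) := by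
        rw [Finset.sum_image hinj]
    _ ≤ ∑ k ∈ Finset.range (2 ^ m), W m (Φ.flow ((k : ℝ) * hm') z) := by
        refine Finset.sum_le_sum_of_subset_of_nonneg (fun k hk => ?_) fun _ _ _ => bot_le
        obtain ⟨t, -, rfl⟩ := Finset.mem_image.1 hk
        exact Finset.mem_range.2 (hf1 t)
    _ = ∑ k ∈ Finset.range (2 ^ m), W m (Φ.flow (k * (τ / 2 ^ m)) z) := by simp only [hhm]

/-- **Mean form of the majorant (any law carried by the good set).**  For every measure `P` on phase space
with `P(goodᶜ) = 0` — e.g. any law absolutely continuous with respect to the Liouville measure — the lower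
Lebesgue integral of the item's collision functional over `[0, τ]` is at most
`liminf_m Σ_{k < 2^m} ∫ W_m ∘ Φ_{k h_m} dP` (Fatou), with the lifted pair weights `g_m` of
`exists_temperedSum_majorant`.  This is the reduction of `TemperedCollisions` to one-window bounds ALONG THE
EVOLVED LAW `P ∘ Φ_s⁻¹`; under a flow-invariant `P` the windows all have the same mean (rung 0). [folklore] -/
theorem lintegral_temperedSum_le_liminf {ε : ℝ} (hε : 0 < ε) {N : ℕ}
    (Φ : HardSphereFlow (Torus.geometry (Fin 3)) ε N) {τ : ℝ} (hτ : 0 < τ)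
    (P : Measure (Config N (Fin 3) T3)) (hP : P Φ.goodᶜ = 0) :
    ∃ g : ℕ → T3 → V3 → ℝ≥0∞,
      (∀ m, Measurable (Function.uncurry (g m))) ∧
      (∀ m (c : T3) (u : V3), ∫⁻ y, g m (y - c) u ≤ ENNReal.ofReal (2 * Real.pi * ε ^ 2 * (τ / 2 ^ m))) ∧
      ∫⁻ z, ENNReal.ofReal (∑ᶠ t ∈ collisionTimes (Torus.geometry (Fin 3)) ε (fun s => Φ.flow s z) ∩ Icc 0 τ,
            ∑ p : Fin N, ∑ q ∈ Finset.univ.erase p,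
              (contactSet (Torus.geometry (Fin 3)) N ε p q).indicator
                (fun y : Config N (Fin 3) T3 =>
                  ε / |⟪(Torus.geometry (Fin 3)).sepVec (y p).1 (y q).1, (y p).2 - (y q).2⟫_ℝ|) (Φ.flow t z)) ∂P ≤
        liminf (fun m => ∑ k ∈ Finset.range (2 ^ m),
          ∫⁻ z, ∑ p : Fin N, ∑ q ∈ Finset.univ.erase p,
            g m ((Φ.flow (k * (τ / 2 ^ m)) z p).1 - (Φ.flow (k * (τ / 2 ^ m)) z q).1)
              ((Φ.flow (k * (τ / 2 ^ m)) z p).2 - (Φ.flow (k * (τ / 2 ^ m)) z q).2) ∂P) atTop := by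
  obtain ⟨g, hgm, hgint, hmaj⟩ := exists_temperedSum_majorant hε Φ hτ
  refine ⟨g, hgm, hgint, ?_⟩
  set c : ℕ → Config N (Fin 3) T3 → ℝ≥0∞ := fun m z => ∑ k ∈ Finset.range (2 ^ m),
    ∑ p : Fin N, ∑ q ∈ Finset.univ.erase p,
      g m ((Φ.flow (k * (τ / 2 ^ m)) z p).1 - (Φ.flow (k * (τ / 2 ^ m)) z q).1)
        ((Φ.flow (k * (τ / 2 ^ m)) z p).2 - (Φ.flow (k * (τ / 2 ^ m)) z q).2) with hc
  have hck : ∀ m (k : ℕ), Measurable fun z : Config N (Fin 3) T3 =>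
      ∑ p : Fin N, ∑ q ∈ Finset.univ.erase p,
        g m ((Φ.flow (k * (τ / 2 ^ m)) z p).1 - (Φ.flow (k * (τ / 2 ^ m)) z q).1)
          ((Φ.flow (k * (τ / 2 ^ m)) z p).2 - (Φ.flow (k * (τ / 2 ^ m)) z q).2) :=
    fun m k => (measurable_pairSum (hgm m)).comp (Φ.measurable_flow _)
  have hcm : ∀ m, Measurable (c m) := fun m => Finset.measurable_sum _ fun k _ => hck m k
  have hgood : ∀ᵐ z ∂P, z ∈ Φ.good := ae_iff.2 hP
  calc _ ≤ ∫⁻ z, liminf (fun m => c m z) atTop ∂P := by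
        refine lintegral_mono_ae ?_
        filter_upwards [hgood] with z hz using hmaj z hz
    _ ≤ liminf (fun m => ∫⁻ z, c m z ∂P) atTop := lintegral_liminf_le hcm
    _ = liminf (fun m => ∑ k ∈ Finset.range (2 ^ m), ∫⁻ z, ∑ p : Fin N, ∑ q ∈ Finset.univ.erase p,
            g m ((Φ.flow (k * (τ / 2 ^ m)) z p).1 - (Φ.flow (k * (τ / 2 ^ m)) z q).1)
              ((Φ.flow (k * (τ / 2 ^ m)) z p).2 - (Φ.flow (k * (τ / 2 ^ m)) z q).2) ∂P) atTop := by
        refine liminf_congr (Eventually.of_forall fun m => ?_)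
        simp only [hc]
        rw [lintegral_finsetSum _ fun k _ => hck m k]


end Summit.AtomisticToContinuum.HydrodynamicLimit.Theorems

end
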